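import Mathlib
import Summits.QuantumFields.YangMills.Theorems.FemtoTransferGapSlabFlowLift
import Summits.QuantumFields.YangMills.Theorems.FemtoTransferGapBounds
import HarnessLib

/-!
# Slow projection for route `StiffComplementSchur` (support for item stmt-QuantumFields-23303 `SchurEnclosureP`)

For the Ω-dressed flowed-Polyakov slow family `V = {s_f := (f ∘ proj)·Ω : f a physical one-site function}`,
`proj = polyakovSite x₀ ∘ wilsonFlow t`, every physical zero-flux test function `ψ` of the fine theory splits EXACTLY as
`ψ = s_h + g` with `h` a physical one-site function and `g` physical and `l2`-orthogonal to all of `V`.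

Construction (pure measure theory): `h ∘ proj` is (a bounded, everywhere-invariant version of) the conditional expectation of `ψ/Ω`
for the finite measure `Ω²·dU` with respect to the pull-back along `proj` of the σ-algebra of one-site events invariant under all
one-site gauge transformations and centre twists (`MeasurableSpace.invariants`, an infimum of them); Doob–Dynkin factorisation
(`StronglyMeasurable.exists_eq_measurable_comp`) through that σ-algebra makes `h` invariant EVERYWHERE, hence physical; the defining
property of the conditional expectation against the test functions `f ∘ proj` is the orthogonality.

HONEST FRAMING: bookkeeping for the Schur enclosure; nothing here bears on infinite volume, the continuum or the Clay gap; the YM mass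
gap is NOT proved.  No `sorry`, no new axiom, no new definition.
References: [cite: ReedSimonIV1978, Thm. XIII.1]; [cite: GustafsonSigal2003, §11.1] (Feshbach–Schur slow variable).
-/

set_option autoImplicit false

noncomputable section

open MeasureTheory Filter Topology Real
open Literature.MathematicalPhysics.QuantumFieldTheory (GaugeConfig Site gaugeTransform wilsonFlow measurable_wilsonFlow)
open Literature.MathematicalPhysics.QuantumLattice (secondCountableTopology_su2)

namespace Summit.QuantumFields.YangMills.Theorems.StiffComplementSchur

open Summit.QuantumFields.YangMills.Theorems.FemtoTransferGap

variable {L : ℕ} [NeZero L]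

/-! ## §1 One-site invariance bookkeeping -/

/-- A physical one-site function is measurable for the invariant σ-algebra `⨅ γ, invariants (act γ)`. [folklore] -/
theorem measurable_iInf_invariants_of_isPhys {f : GaugeConfig 3 1 SU2 → ℝ} (hf : IsPhys f) :
    Measurable[⨅ γ : (Site 3 1 → SU2) ⊕ (Fin 3 × ↥(Subgroup.center SU2)),
      MeasurableSpace.invariants
        (Sum.elim (fun g => gaugeTransform g) (fun p => twist p.1 (p.2 : SU2)) γ)] f := by
  intro s hs
  refine MeasurableSpace.measurableSet_iInf.2 fun γ => ?_
  refine ⟨hf.measurable hs, ?_⟩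
  rcases γ with g | ⟨k, z⟩
  · ext u
    simp only [Sum.elim_inl, Set.mem_preimage, hf.gaugeInv g u]
  · ext u
    simp only [Sum.elim_inr, Set.mem_preimage, hf.zeroFlux k z z.2 u]

/-- A bounded function measurable for the invariant σ-algebra is a physical one-site function. [folklore] -/
theorem isPhys_of_measurable_iInf_invariants {h : GaugeConfig 3 1 SU2 → ℝ}
    (hm : Measurable[⨅ γ : (Site 3 1 → SU2) ⊕ (Fin 3 × ↥(Subgroup.center SU2)),
      MeasurableSpace.invariants
        (Sum.elim (fun g => gaugeTransform g) (fun p => twist p.1 (p.2 : SU2)) γ)] h)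
    {R : ℝ} (hR : ∀ u, |h u| ≤ R) : IsPhys h := by
  have hγ : ∀ γ : (Site 3 1 → SU2) ⊕ (Fin 3 × ↥(Subgroup.center SU2)),
      Measurable[MeasurableSpace.invariants
        (Sum.elim (fun g => gaugeTransform g) (fun p => twist p.1 (p.2 : SU2)) γ)] h :=
    fun γ => hm.mono (iInf_le _ γ) le_rfl
  refine ⟨?_, ⟨R, hR⟩, fun g u => ?_, fun k z hz u => ?_⟩
  · exact (hγ (Sum.inl fun _ => 1)).mono (MeasurableSpace.invariants_le _) le_rfl
  · have h1 := MeasurableSpace.comp_eq_of_measurable_invariants (hγ (Sum.inl g))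
    exact congr_fun h1 u
  · have h1 := MeasurableSpace.comp_eq_of_measurable_invariants (hγ (Sum.inr (k, ⟨z, hz⟩)))
    exact congr_fun h1 u

/-! ## §2 Conditional expectation through a sub-σ-algebra of the target (abstract) -/

/-- **Bounded invariant version of a conditional expectation along a map.**  `X`, `Y` measurable spaces, `m𝓘 ≤` the σ-algebra
of `Y`, `proj : X → Y` measurable, `ν` a finite measure on `X`, `ψt` measurable with `|ψt| ≤ R`.  Then there is `h : Y → ℝ`,
`m𝓘`-measurable with `|h| ≤ R` everywhere, such that `∫ (f∘proj)·(h∘proj) dν = ∫ (f∘proj)·ψt dν` for every bounded `m𝓘`-measurable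
`f` (`h ∘ proj` is a version of `ν[ψt | m𝓘.comap proj]`, by Doob–Dynkin factorisation and truncation).
[cite: ReedSimonIV1978, Thm. XIII.1] -/
theorem exists_bounded_condExp_factor {X Y : Type*} {m𝓘 : MeasurableSpace Y} [MeasurableSpace X]
    [MeasurableSpace Y] (hle : m𝓘 ≤ ‹MeasurableSpace Y›) {proj : X → Y} (hproj : Measurable proj)
    (ν : Measure X) [IsFiniteMeasure ν] {ψt : X → ℝ} (hψtm : Measurable ψt) {R : ℝ} (hR : 0 ≤ R)
    (hb : ∀ x, |ψt x| ≤ R) :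
    ∃ h : Y → ℝ, Measurable[m𝓘] h ∧ (∀ y, |h y| ≤ R) ∧
      ∀ f : Y → ℝ, Measurable[m𝓘] f → (∃ Cf : ℝ, ∀ y, |f y| ≤ Cf) →
        ∫ x, f (proj x) * h (proj x) ∂ν = ∫ x, f (proj x) * ψt x ∂ν := by
  have h𝓕le : m𝓘.comap proj ≤ ‹MeasurableSpace X› := (MeasurableSpace.comap_mono hle).trans hproj.comap_le
  have hproj𝓕 : Measurable[m𝓘.comap proj, m𝓘] proj := comap_measurable proj
  haveI : SigmaFinite (ν.trim h𝓕le) := inferInstance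
  have hψti : Integrable ψt ν :=
    ⟨hψtm.aestronglyMeasurable, HasFiniteIntegral.of_bounded (C := R)
      (ae_of_all _ fun x => by rw [Real.norm_eq_abs]; exact hb x)⟩
  -- the conditional expectation and its Doob–Dynkin factorisation through `m𝓘`
  have hE : StronglyMeasurable[m𝓘.comap proj] (ν[ψt | m𝓘.comap proj]) := stronglyMeasurable_condExp
  obtain ⟨h₀, hh₀, hEq⟩ := StronglyMeasurable.exists_eq_measurable_comp (mY := m𝓘) hE
  have hh₀m : Measurable[m𝓘] h₀ := hh₀.measurable
  have hEbd : ∀ᵐ x ∂ν, |(ν[ψt | m𝓘.comap proj]) x| ≤ R :=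
    ae_bdd_abs_condExp_of_ae_bdd_abs (ae_of_all _ fun x => hb x)
  -- truncate to get an everywhere-bounded version
  refine ⟨fun y => max (-R) (min R (h₀ y)), ?_, fun y => ?_, fun f hf hfb => ?_⟩
  · exact Measurable.max measurable_const (Measurable.min measurable_const hh₀m)
  · rw [abs_le]
    exact ⟨le_max_left _ _, max_le (by linarith) (min_le_left _ _)⟩
  obtain ⟨Cf, hCf⟩ := hfb
  have hhE : ∀ᵐ x ∂ν, max (-R) (min R (h₀ (proj x))) = (ν[ψt | m𝓘.comap proj]) x := by
    filter_upwards [hEbd] with x hx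
    have hx' : (ν[ψt | m𝓘.comap proj]) x = h₀ (proj x) := congr_fun hEq x
    rw [abs_le] at hx
    rw [← hx', min_eq_right hx.2, max_eq_right hx.1]
  -- the test function `θ = f ∘ proj`
  have hθ𝓕 : Measurable[m𝓘.comap proj] (fun x => f (proj x)) := hf.comp hproj𝓕
  have hθm : Measurable (fun x => f (proj x)) := hθ𝓕.mono h𝓕le le_rfl
  have hθψti : Integrable ((fun x => f (proj x)) * ψt) ν :=
    ⟨(hθm.mul hψtm).aestronglyMeasurable, HasFiniteIntegral.of_bounded (C := Cf * R)
      (ae_of_all _ fun x => by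
        have h1 := mul_le_mul (hCf (proj x)) (hb x) (abs_nonneg _) ((abs_nonneg _).trans (hCf (proj x)))
        simpa only [Real.norm_eq_abs, Pi.mul_apply, abs_mul] using h1)⟩
  have hpull : ν[(fun x => f (proj x)) * ψt | m𝓘.comap proj] =ᵐ[ν]
      (fun x => f (proj x)) * ν[ψt | m𝓘.comap proj] :=
    condExp_mul_of_stronglyMeasurable_left hθ𝓕.stronglyMeasurable hθψti hψti
  have hkey : ∫ x, f (proj x) * (ν[ψt | m𝓘.comap proj]) x ∂ν = ∫ x, f (proj x) * ψt x ∂ν := by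
    have h1 : ∫ x, f (proj x) * (ν[ψt | m𝓘.comap proj]) x ∂ν =
        ∫ x, (ν[(fun x => f (proj x)) * ψt | m𝓘.comap proj]) x ∂ν :=
      integral_congr_ae (by filter_upwards [hpull] with x hx; rw [hx]; rfl)
    rw [h1, integral_condExp h𝓕le]
    rfl
  rw [← hkey]
  exact integral_congr_ae (by filter_upwards [hhE] with x hx; rw [hx])

/-! ## §3 The slow projection -/

/-- ★ **Slow projection.**  For a physical, uniformly positive `Ω`, a base point `x₀`, a flow time `t` and a physical `ψ` there is a
physical ONE-SITE function `h` with `⟨ψ, s_f⟩ = ⟨s_h, s_f⟩` for every physical one-site `f`, where `s_f = (flowLiftAt x₀ t f)·Ω`;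
i.e. `ψ − s_h` is `l2`-orthogonal to the whole Ω-dressed flowed-Polyakov slow family.  (`h ∘ proj` = the conditional expectation of
`ψ/Ω` under `Ω² dU` given the invariant one-site events of `proj = polyakovSite x₀ ∘ wilsonFlow t`.)
[cite: ReedSimonIV1978, Thm. XIII.1] [cite: GustafsonSigal2003, §11.1] -/
theorem exists_slowProjection {Ω : GaugeConfig 3 L SU2 → ℝ} (hΩ : IsPhys Ω) {c : ℝ} (hc : 0 < c)
    (hcΩ : ∀ U, c ≤ Ω U) (x₀ : Site 3 L) (t : ℝ) {ψ : GaugeConfig 3 L SU2 → ℝ} (hψ : IsPhys ψ) :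
    ∃ h : GaugeConfig 3 1 SU2 → ℝ, IsPhys h ∧
      ∀ f : GaugeConfig 3 1 SU2 → ℝ, IsPhys f →
        l2 ψ (fun U => flowLiftAt x₀ t f U * Ω U) =
          l2 (fun U => flowLiftAt x₀ t h U * Ω U) (fun U => flowLiftAt x₀ t f U * Ω U) := by
  haveI : SecondCountableTopology SU2 := secondCountableTopology_su2
  -- the slow variable
  have hproj : Measurable (fun U : GaugeConfig 3 L SU2 => polyakovSite x₀ (wilsonFlow t U)) :=
    (continuous_polyakovSite x₀).measurable.comp (measurable_wilsonFlow t)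
  -- the invariant σ-algebra is a sub-σ-algebra
  have hle := le_trans
    (iInf_le (fun γ : (Site 3 1 → SU2) ⊕ (Fin 3 × ↥(Subgroup.center SU2)) =>
      MeasurableSpace.invariants
        (Sum.elim (fun g => gaugeTransform g) (fun p => twist p.1 (p.2 : SU2)) γ)) (Sum.inl fun _ => 1))
    (MeasurableSpace.invariants_le
      (Sum.elim (fun g : Site 3 1 → SU2 => gaugeTransform g)
        (fun p : Fin 3 × ↥(Subgroup.center SU2) => twist p.1 (p.2 : SU2)) (Sum.inl fun _ => 1)))
  -- the finite measure `ν = Ω² dU`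
  have hdens : Measurable (fun U : GaugeConfig 3 L SU2 => ENNReal.ofReal (Ω U ^ 2)) :=
    (hΩ.measurable.pow_const 2).ennreal_ofReal
  haveI hνfin : IsFiniteMeasure ((configMeasure SU2 L).withDensity fun U => ENNReal.ofReal (Ω U ^ 2)) :=
    isFiniteMeasure_withDensity_ofReal hΩ.integrable_sq.hasFiniteIntegral
  -- bounds on `ψ/Ω`
  obtain ⟨Cψ, hCψ⟩ := hψ.bounded
  have hΩpos : ∀ U, 0 < Ω U := fun U => hc.trans_le (hcΩ U)
  have hψtm : Measurable (fun U => ψ U / Ω U) := hψ.measurable.div hΩ.measurable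
  have hR0 : 0 ≤ Cψ / c := div_nonneg ((abs_nonneg _).trans (hCψ (fun _ => 1))) hc.le
  have hψtb : ∀ U, |ψ U / Ω U| ≤ Cψ / c := by
    intro U
    rw [abs_div, abs_of_pos (hΩpos U)]
    exact div_le_div₀ ((abs_nonneg _).trans (hCψ U)) (hCψ U) hc (hcΩ U)
  -- the abstract factorisation
  obtain ⟨h, hhm, hhb, hint⟩ := exists_bounded_condExp_factor hle hproj
    ((configMeasure SU2 L).withDensity fun U => ENNReal.ofReal (Ω U ^ 2)) hψtm hR0 hψtb
  have hhphys : IsPhys h := isPhys_of_measurable_iInf_invariants hhm hhb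
  refine ⟨h, hhphys, fun f hf => ?_⟩
  have hf𝓘 := measurable_iInf_invariants_of_isPhys hf
  have hkey := hint f hf𝓘 hf.bounded
  -- back to `dU`
  have hlt : ∀ᵐ U ∂(configMeasure SU2 L), (fun U : GaugeConfig 3 L SU2 => ENNReal.ofReal (Ω U ^ 2)) U < ⊤ :=
    ae_of_all _ fun U => ENNReal.ofReal_lt_top
  have hconv : ∀ F : GaugeConfig 3 L SU2 → ℝ,
      ∫ U, F U ∂((configMeasure SU2 L).withDensity fun U => ENNReal.ofReal (Ω U ^ 2)) =
        ∫ U, Ω U ^ 2 * F U ∂(configMeasure SU2 L) := by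
    intro F
    rw [integral_withDensity_eq_integral_toReal_smul hdens hlt]
    refine integral_congr_ae (ae_of_all _ fun U => ?_)
    dsimp only
    rw [ENNReal.toReal_ofReal (sq_nonneg _), smul_eq_mul]
  rw [hconv, hconv] at hkey
  -- identify both sides
  unfold l2
  have hl : (fun U => ψ U * (flowLiftAt x₀ t f U * Ω U)) =
      fun U => Ω U ^ 2 * (f (polyakovSite x₀ (wilsonFlow t U)) * (ψ U / Ω U)) := by
    funext U
    have hΩU : Ω U ≠ 0 := (hΩpos U).ne'
    simp only [flowLiftAt]
    field_simp
  have hr : (fun U => flowLiftAt x₀ t h U * Ω U * (flowLiftAt x₀ t f U * Ω U)) =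
      fun U => Ω U ^ 2 * (f (polyakovSite x₀ (wilsonFlow t U)) * h (polyakovSite x₀ (wilsonFlow t U))) := by
    funext U
    simp only [flowLiftAt]
    ring
  rw [hl, hr, hkey]

end Summit.QuantumFields.YangMills.Theorems.StiffComplementSchur

end
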